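import Mathlib
import Literature.NumberTheory.Automorphic.ZhouLegendreGreenValuesProofs
import Literature.NumberTheory.Transcendental.KZCalculus
import HarnessLib

/-!
# The CM values of Zhou's Remark 9 as 3-dimensional Euler integrals (proofs)

Proved companion of `ZhouLegendreGreenValues.lean` / `ZhouLegendreGreenValuesProofs.lean` for route
`KontsevichZagierPeriods/TorsionLogsGKZ` (items stmt-KontsevichZagierPeriods-4040/4041, definition
request `higherGreenFunctionCM`): the numbers

* `J₁ := ∫_{(0,1)³} ∏_{u ∈ {t, s}} u^{-1/6} (1-u)^{-5/6} (1 - (1-ξ)u/2)^{-1/6} dt ds dξ`,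
* `J₃ := ∫_{(0,1)³} ∏_{u ∈ {t, s}} u^{-1/3} (1-u)^{-2/3} (1 - (1-ξ)u/2)^{-1/3} dt ds dξ`,

which are the left-hand sides of the two Gross–Kohnen–Zagier test pairs of the route (the
`KZ.IntegralRep 3` with domain the open unit cube and these integrands), are computed
UNCONDITIONALLY:

  `J₁ = (2π)² ∫₀¹ P_{-1/6}(ξ)² dξ = 6√3 · π · log(2 + √3)`,  `J₃ = 4√3 · π · log 2`

(`integral_cube_level_one`, `integral_cube_level_three`, each together with the absolute
integrability of the integrand on the cube, which is what `KZ.IntegralRep.integrableOn` asks; and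
`KZ_value_level_one`, `KZ_value_level_three`: every `KZ.IntegralRep 3` with this domain and an
integrand agreeing with it on the domain — the hypotheses of `GKZLevelOnePair`/`GKZLevelThreePair` —
has this `value`).

The argument is the one indicated in the route ("Euler integral for ₂F₁ + Fubini"): by Euler's
integral representation (Zhou 2015, eq. (Euler_int), p. 17; Andrews–Askey–Roy Thm. 2.2.1 — the tree's
`LegendreP.euler_integral_ordinaryHypergeometric`) with `a = -ν`, `b = ν + 1`, `c = 1`,
`x = (1-ξ)/2`, for `-1 < ν < 0`,

  `∫₀¹ t^ν (1-t)^{-ν-1} (1 - (1-ξ)t/2)^ν dt = Γ(ν+1) Γ(-ν) · P_ν(ξ)`   (`integral_eulerKernel`),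

so by Tonelli/Fubini on `(0,1) × (0,1)²` (Mathlib's `measurePreserving_piFinSuccAbove`,
`integral_prod`, `integral_fintype_prod_eq_pow`) the cube integral of
`K_ν(x₀, x₂) K_ν(x₁, x₂)`, `K_ν(t, ξ)` the Euler kernel above, equals
`(Γ(ν+1)Γ(-ν))² ∫₀¹ P_ν(ξ)² dξ` (`integral_cube_eulerKernel`, general `-1 < ν < 0`). With
`Γ(5/6)Γ(1/6) = 2π`, `Γ(2/3)Γ(1/3) = 2π/√3` (reflection formula) and the PROVED values
`∫₀¹ P_{-1/3}² = (3√3/π) log 2` and `∫₀¹ P_{-1/6}² = (3√3/(2π)) log(2+√3)` of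
`ZhouLegendreGreenValuesProofs.lean` (`LegendreP.integral_legendreP_neg_one_third_sq`,
`LegendreP.integral_legendreP_neg_one_sixth_sq`; Zhou 2015, Remark 9) this gives the two values.
Combined with the Green's-function representations of Zhou's Remark 9 (the remaining, unproved
conjuncts of the named fact `Zhou2015_legendreP_sq_integral`): `J₁ = -(3π/4) · higherGreen 1 2 1 ρ i`
and `J₃ = -√3 π · higherGreen 3 2 1 ((3+i√3)/6) (i/√3)`.

## References

* [Zhou2015] Y. Zhou, Ramanujan J. 38 (2015), arXiv:1312.6352: eq. (Euler_int) p. 17, Remark 9 p. 19.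
* [AndrewsAskeyRoy1999] G. Andrews, R. Askey, R. Roy, *Special Functions*, Thm. 2.2.1 (Euler's integral).
-/

noncomputable section

open Real Set MeasureTheory intervalIntegral
open scoped Topology

namespace Literature.NumberTheory.Automorphic

namespace LegendreP

/-! ## The Euler kernel and its integral in `t` -/

/-- The **Euler kernel** `K_ν(t, ξ) := t^ν (1 - t)^{-ν-1} (1 - (1-ξ)t/2)^ν`: the integrand of
Euler's integral for `P_ν(ξ) = ₂F₁(-ν, ν+1; 1; (1-ξ)/2)` (`a = -ν`, `b = ν+1`, `c = 1`,
`x = (1-ξ)/2`: `t^{b-1}(1-t)^{c-b-1}(1-xt)^{-a}`). [cite: Zhou2015, eq. (Euler_int) (arXiv p. 17)] -/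
def eulerKernel (ν t ξ : ℝ) : ℝ :=
  t ^ ν * (1 - t) ^ (-ν - 1) * (1 - (1 - ξ) * t / 2) ^ ν

/-- **Euler's integral for `P_ν`**: `∫₀¹ K_ν(t, ξ) dt = Γ(ν+1) Γ(-ν) P_ν(ξ)` for `-1 < ν < 0` and
`-1 < ξ < 3` (so that `|x| = |1-ξ|/2 < 1`), from `euler_integral_ordinaryHypergeometric`
(`Γ(c) = Γ(1) = 1`). [cite: Zhou2015, eq. (Euler_int) (arXiv p. 17)] -/
theorem integral_eulerKernel {ν ξ : ℝ} (hν : -1 < ν) (hν0 : ν < 0) (h1 : -1 < ξ) (h3 : ξ < 3) :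
    ∫ t in (0 : ℝ)..1, eulerKernel ν t ξ =
      Real.Gamma (ν + 1) * Real.Gamma (-ν) * legendreP ν ξ := by
  have hx : |(1 - ξ) / 2| < 1 := abs_half_sub_lt_one h1 h3
  have h := euler_integral_ordinaryHypergeometric (a := -ν) (b := ν + 1) (c := 1)
    (x := (1 - ξ) / 2) (by linarith) (by linarith) hx
  have e1 : ν + 1 - 1 = ν := by ring
  have e3 : 1 - (ν + 1) = -ν := by ring
  have e4 : ∀ t : ℝ, 1 - (1 - ξ) / 2 * t = 1 - (1 - ξ) * t / 2 := fun t => by ring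
  simp only [e1, e3, e4, neg_neg, Real.Gamma_one, div_one] at h
  rw [legendreP_def]
  exact h

/-- `K_ν(t, ξ) ≥ 0` for `0 ≤ t ≤ 1`, `0 ≤ ξ` (all three bases are non-negative). [folklore] -/
theorem eulerKernel_nonneg {ν t ξ : ℝ} (ht0 : 0 ≤ t) (ht1 : t ≤ 1) (hξ0 : 0 ≤ ξ) :
    0 ≤ eulerKernel ν t ξ := by
  unfold eulerKernel
  have h1 : 0 ≤ 1 - t := by linarith
  have h2 : 0 ≤ 1 - (1 - ξ) * t / 2 := by nlinarith
  exact mul_nonneg (mul_nonneg (Real.rpow_nonneg ht0 _) (Real.rpow_nonneg h1 _))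
    (Real.rpow_nonneg h2 _)

/-- `(t, ξ) ↦ K_ν(t, ξ)` is (Borel) measurable. [folklore] -/
theorem measurable_eulerKernel (ν : ℝ) :
    Measurable fun p : ℝ × ℝ => eulerKernel ν p.1 p.2 := by
  unfold eulerKernel
  fun_prop

/-- `t ↦ K_ν(t, ξ)` is integrable on `(0, 1)` for `-1 < ν < 0`, `0 ≤ ξ`: the Beta part
`t^{(ν+1)-1}(1-t)^{(-ν)-1}` is (`intervalIntegrable_rpow_mul_one_sub_rpow`) and the last factor is
continuous on `[0, 1]` (its base is `≥ (1+ξ)/2 > 0`). [folklore] -/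
theorem intervalIntegrable_eulerKernel {ν ξ : ℝ} (hν : -1 < ν) (hν0 : ν < 0) (hξ0 : 0 ≤ ξ) :
    IntervalIntegrable (fun t => eulerKernel ν t ξ) volume 0 1 := by
  have hw := intervalIntegrable_rpow_mul_one_sub_rpow (p := ν + 1) (q := -ν) (by linarith)
    (by linarith)
  have e1 : ν + 1 - 1 = ν := by ring
  simp only [e1] at hw
  refine (hw.mul_continuousOn (g := fun t => (1 - (1 - ξ) * t / 2) ^ ν) ?_).congr ?_
  · apply ContinuousOn.rpow_const (by fun_prop)
    intro t ht
    left
    rw [Set.uIcc_of_le zero_le_one] at ht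
    nlinarith [ht.1, ht.2]
  · intro t _
    simp only [eulerKernel]

/-- `IntegrableOn` form of `intervalIntegrable_eulerKernel`. [folklore] -/
theorem integrableOn_eulerKernel {ν ξ : ℝ} (hν : -1 < ν) (hν0 : ν < 0) (hξ0 : 0 ≤ ξ) :
    IntegrableOn (fun t => eulerKernel ν t ξ) (Ioo 0 1) := by
  have := intervalIntegrable_eulerKernel hν hν0 hξ0
  rw [intervalIntegrable_iff_integrableOn_Ioo_of_le zero_le_one] at this
  exact this

/-- Euler's integral as a set integral over `(0, 1)`. [cite: Zhou2015, eq. (Euler_int) (arXiv p. 17)] -/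
theorem setIntegral_eulerKernel {ν ξ : ℝ} (hν : -1 < ν) (hν0 : ν < 0) (hξ0 : 0 ≤ ξ)
    (hξ1 : ξ ≤ 1) :
    ∫ t in Ioo (0:ℝ) 1, eulerKernel ν t ξ =
      Real.Gamma (ν + 1) * Real.Gamma (-ν) * legendreP ν ξ := by
  rw [← integral_eulerKernel hν hν0 (by linarith) (by linarith),
    intervalIntegral.integral_of_le zero_le_one, integral_Ioc_eq_integral_Ioo]

/-! ## Fubini on the open unit cube -/

/-- The open unit cube `{x | ∀ i, 0 < xᵢ < 1} ⊆ ℝ³` is the product set `∏ᵢ (0, 1)`. [folklore] -/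
theorem cube_eq_pi :
    {x : Fin 3 → ℝ | ∀ i, x i ∈ Ioo (0:ℝ) 1} = Set.univ.pi fun _ => Ioo (0:ℝ) 1 := by
  ext x; simp

/-- Lebesgue measure restricted to the open unit cube is the product of the restricted
one-dimensional measures (`Measure.restrict_pi_pi`). [folklore] -/
theorem volume_restrict_cube :
    (volume : Measure (Fin 3 → ℝ)).restrict {x : Fin 3 → ℝ | ∀ i, x i ∈ Ioo (0:ℝ) 1} =
      Measure.pi fun _ : Fin 3 => (volume : Measure ℝ).restrict (Ioo 0 1) := by
  rw [cube_eq_pi, volume_pi, Measure.restrict_pi_pi]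

/-- **The cube integral of `K_ν(x₀, x₂) K_ν(x₁, x₂)`** (`-1 < ν < 0`): the integrand is absolutely
integrable on the open unit cube and
`∫_{(0,1)³} K_ν(x₀, x₂) K_ν(x₁, x₂) dx = (Γ(ν+1)Γ(-ν))² ∫₀¹ P_ν(ξ)² dξ` — Euler's integral in `x₀` and
in `x₁` for fixed `ξ = x₂` (Tonelli/Fubini: split off the coordinate `x₂` by
`measurePreserving_piFinSuccAbove`, then `integral_fintype_prod_eq_pow` on `(0,1)²`; integrability
on the product from `integrable_prod_iff`, the inner `L¹` norms being `(Γ(ν+1)Γ(-ν) P_ν(ξ))²`,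
continuous on `[0, 1]`). [cite: Zhou2015, Remark 9 with eq. (Euler_int) (arXiv pp. 17, 19)] -/
theorem integral_cube_eulerKernel {ν : ℝ} (hν : -1 < ν) (hν0 : ν < 0) :
    (IntegrableOn (fun x : Fin 3 → ℝ => eulerKernel ν (x 0) (x 2) * eulerKernel ν (x 1) (x 2))
        {x : Fin 3 → ℝ | ∀ i, x i ∈ Ioo (0:ℝ) 1}) ∧
    ∫ x in {x : Fin 3 → ℝ | ∀ i, x i ∈ Ioo (0:ℝ) 1},
        eulerKernel ν (x 0) (x 2) * eulerKernel ν (x 1) (x 2) =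
      (Real.Gamma (ν + 1) * Real.Gamma (-ν)) ^ 2 * ∫ ξ in (0:ℝ)..1, legendreP ν ξ ^ 2 := by
  set μ₁ : Measure ℝ := (volume : Measure ℝ).restrict (Ioo 0 1) with hμ₁
  haveI : IsFiniteMeasure μ₁ := by rw [hμ₁]; infer_instance
  set B : ℝ := Real.Gamma (ν + 1) * Real.Gamma (-ν) with hB
  -- the transported integrand on `ℝ × (Fin 2 → ℝ)`
  set G : ℝ × (Fin 2 → ℝ) → ℝ :=
    fun p => eulerKernel ν (p.2 0) p.1 * eulerKernel ν (p.2 1) p.1 with hG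
  have hGprod : ∀ ξ : ℝ, (fun y : Fin 2 → ℝ => G (ξ, y)) =
      fun y => ∏ i : Fin 2, (fun t => eulerKernel ν t ξ) (y i) := by
    intro ξ; funext y; simp [hG, Fin.prod_univ_two]
  set e := MeasurableEquiv.piFinSuccAbove (fun _ : Fin 3 => ℝ) 2 with he
  have hmp : MeasurePreserving e (Measure.pi fun _ : Fin 3 => μ₁)
      (μ₁.prod (Measure.pi fun _ : Fin 2 => μ₁)) :=
    measurePreserving_piFinSuccAbove (fun _ : Fin 3 => μ₁) 2
  have hs0 : (2 : Fin 3).succAbove 0 = 0 := by decide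
  have hs1 : (2 : Fin 3).succAbove 1 = 1 := by decide
  have hFG :
      (fun x : Fin 3 → ℝ => eulerKernel ν (x 0) (x 2) * eulerKernel ν (x 1) (x 2)) = G ∘ e := by
    funext x
    simp [hG, he, MeasurableEquiv.piFinSuccAbove_apply, Fin.removeNth, hs0, hs1]
  -- measurability of `G`
  have hGm : Measurable G := by
    simp only [hG, eulerKernel]
    fun_prop
  -- the inner integrals
  have hinner_int : ∀ ξ ∈ Ioo (0:ℝ) 1,
      Integrable (fun y : Fin 2 → ℝ => G (ξ, y)) (Measure.pi fun _ : Fin 2 => μ₁) := by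
    intro ξ hξ
    rw [hGprod ξ]
    exact Integrable.fintype_prod (f := fun _ t => eulerKernel ν t ξ)
      (fun _ => integrableOn_eulerKernel hν hν0 hξ.1.le)
  have hinner_val : ∀ ξ ∈ Ioo (0:ℝ) 1,
      ∫ y : Fin 2 → ℝ, G (ξ, y) ∂(Measure.pi fun _ : Fin 2 => μ₁) = (B * legendreP ν ξ) ^ 2 := by
    intro ξ hξ
    rw [hGprod ξ, integral_fintype_prod_eq_pow (ι := Fin 2) (f := fun t => eulerKernel ν t ξ),
      Fintype.card_fin, hμ₁, setIntegral_eulerKernel hν hν0 hξ.1.le hξ.2.le]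
  have hinner_norm : ∀ ξ ∈ Ioo (0:ℝ) 1,
      ∫ y : Fin 2 → ℝ, ‖G (ξ, y)‖ ∂(Measure.pi fun _ : Fin 2 => μ₁) = (B * legendreP ν ξ) ^ 2 := by
    intro ξ hξ
    rw [← hinner_val ξ hξ]
    apply MeasureTheory.integral_congr_ae
    have hae : ∀ᵐ y : Fin 2 → ℝ ∂(Measure.pi fun _ : Fin 2 => μ₁), ∀ i, y i ∈ Ioo (0:ℝ) 1 := by
      rw [ae_all_iff]
      intro i
      have : ∀ᵐ t : ℝ ∂μ₁, t ∈ Ioo (0:ℝ) 1 := by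
        rw [hμ₁]; exact ae_restrict_mem measurableSet_Ioo
      exact (Measure.tendsto_eval_ae_ae (μ := fun _ : Fin 2 => μ₁) (i := i)).eventually this
    filter_upwards [hae] with y hy
    rw [Real.norm_eq_abs, abs_of_nonneg]
    simp only [hG]
    exact mul_nonneg (eulerKernel_nonneg (hy 0).1.le (hy 0).2.le hξ.1.le)
      (eulerKernel_nonneg (hy 1).1.le (hy 1).2.le hξ.1.le)
  -- continuity of `ξ ↦ (B P_ν(ξ))²` gives integrability of the outer integrand
  have hout : Integrable (fun ξ => (B * legendreP ν ξ) ^ 2) μ₁ := by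
    rw [hμ₁]
    have hc : ContinuousOn (fun ξ => (B * legendreP ν ξ) ^ 2) (Icc 0 1) :=
      ((continuousOn_const.mul (continuousOn_legendreP_Icc ν)).pow 2)
    exact (hc.integrableOn_compact isCompact_Icc).mono_set Ioo_subset_Icc_self
  have hae1 : ∀ᵐ ξ ∂μ₁, ξ ∈ Ioo (0:ℝ) 1 := by rw [hμ₁]; exact ae_restrict_mem measurableSet_Ioo
  -- integrability of `G` on the product
  have hGint : Integrable G (μ₁.prod (Measure.pi fun _ : Fin 2 => μ₁)) := by
    rw [integrable_prod_iff hGm.aestronglyMeasurable]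
    constructor
    · filter_upwards [hae1] with ξ hξ using hinner_int ξ hξ
    · refine hout.congr ?_
      filter_upwards [hae1] with ξ hξ
      exact (hinner_norm ξ hξ).symm
  constructor
  · -- integrability on the cube
    rw [IntegrableOn, volume_restrict_cube, hFG]
    exact (hmp.integrable_comp_emb e.measurableEmbedding).mpr hGint
  · rw [volume_restrict_cube, hFG]
    show ∫ x, G (e x) ∂(Measure.pi fun _ : Fin 3 => μ₁) = _
    rw [hmp.integral_comp', integral_prod G hGint]
    calc ∫ ξ, ∫ y, G (ξ, y) ∂(Measure.pi fun _ : Fin 2 => μ₁) ∂μ₁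
        = ∫ ξ, (B * legendreP ν ξ) ^ 2 ∂μ₁ := by
          apply MeasureTheory.integral_congr_ae
          filter_upwards [hae1] with ξ hξ using hinner_val ξ hξ
      _ = B ^ 2 * ∫ ξ in (0:ℝ)..1, legendreP ν ξ ^ 2 := by
          rw [hμ₁, intervalIntegral.integral_of_le zero_le_one, integral_Ioc_eq_integral_Ioo,
            ← MeasureTheory.integral_const_mul]
          congr 1; funext ξ; ring


/-! ## The two values of the route -/

/-- `Γ(5/6) Γ(1/6) = 2π` (reflection formula, `sin(π/6) = 1/2`). [folklore] -/
theorem Gamma_five_sixths_mul_Gamma_one_sixth :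
    Real.Gamma (-1 / 6 + 1) * Real.Gamma (-(-1 / 6)) = 2 * π := by
  have h := Real.Gamma_mul_Gamma_one_sub (1 / 6 : ℝ)
  rw [show π * (1 / 6 : ℝ) = π / 6 by ring, Real.sin_pi_div_six] at h
  rw [show (-1 / 6 + 1 : ℝ) = 1 - 1 / 6 by norm_num, show (-(-1 / 6) : ℝ) = 1 / 6 by norm_num,
    mul_comm, h]
  ring

/-- `Γ(2/3) Γ(1/3) = 2π/√3` (reflection formula, `sin(π/3) = √3/2`). [folklore] -/
theorem Gamma_two_thirds_mul_Gamma_one_third :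
    Real.Gamma (-1 / 3 + 1) * Real.Gamma (-(-1 / 3)) = 2 * π / √3 := by
  have h := Real.Gamma_mul_Gamma_one_sub (1 / 3 : ℝ)
  rw [show π * (1 / 3 : ℝ) = π / 3 by ring, Real.sin_pi_div_three] at h
  rw [show (-1 / 3 + 1 : ℝ) = 1 - 1 / 3 by norm_num, show (-(-1 / 3) : ℝ) = 1 / 3 by norm_num,
    mul_comm, h]
  have h3 : (√3 : ℝ) ≠ 0 := by positivity
  field_simp

/-- **`J₁ = (2π)² ∫₀¹ P_{-1/6}(ξ)² dξ`** — the 3-dimensional period of item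
stmt-KontsevichZagierPeriods-4040 (level 1, Mellit's case `(ρ, i)` of Gross–Kohnen–Zagier): the
integrand `x₀^{-1/6}(1-x₀)^{-5/6}(1-(1-x₂)x₀/2)^{-1/6} · x₁^{-1/6}(1-x₁)^{-5/6}(1-(1-x₂)x₁/2)^{-1/6}` is
absolutely integrable on the open unit cube and its integral is `(Γ(5/6)Γ(1/6))² ∫₀¹ P_{-1/6}² =
(2π)² ∫₀¹ P_{-1/6}(ξ)² dξ`; with Zhou's `∫₀¹ P_{-1/6}² = (3√3/(2π)) log(2+√3)` (Remark 9; the conjunct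
`h.2.1.2` of the named fact `Zhou2015_legendreP_sq_integral`, proved in the tree as
`LegendreP.integral_legendreP_neg_one_sixth_sq`) this is `6√3 π log(2+√3)` —
`integral_cube_level_one_value`. [cite: Zhou2015, Remark 9 with eq. (Euler_int) (arXiv pp. 17, 19)] -/
theorem integral_cube_level_one :
    IntegrableOn (fun x : Fin 3 → ℝ =>
        (x 0) ^ (-(1:ℝ) / 6) * (1 - x 0) ^ (-(5:ℝ) / 6) * (1 - (1 - x 2) * x 0 / 2) ^ (-(1:ℝ) / 6) *
          ((x 1) ^ (-(1:ℝ) / 6) * (1 - x 1) ^ (-(5:ℝ) / 6) * (1 - (1 - x 2) * x 1 / 2) ^ (-(1:ℝ) / 6)))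
      {x | ∀ i, x i ∈ Set.Ioo (0:ℝ) 1} ∧
    ∫ x in {x : Fin 3 → ℝ | ∀ i, x i ∈ Set.Ioo (0:ℝ) 1},
        (x 0) ^ (-(1:ℝ) / 6) * (1 - x 0) ^ (-(5:ℝ) / 6) * (1 - (1 - x 2) * x 0 / 2) ^ (-(1:ℝ) / 6) *
          ((x 1) ^ (-(1:ℝ) / 6) * (1 - x 1) ^ (-(5:ℝ) / 6) * (1 - (1 - x 2) * x 1 / 2) ^ (-(1:ℝ) / 6))
      = (2 * π) ^ 2 * ∫ ξ in (0:ℝ)..1, legendreP (-1 / 6) ξ ^ 2 := by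
  have hK : (fun x : Fin 3 → ℝ =>
      (x 0) ^ (-(1:ℝ) / 6) * (1 - x 0) ^ (-(5:ℝ) / 6) * (1 - (1 - x 2) * x 0 / 2) ^ (-(1:ℝ) / 6) *
        ((x 1) ^ (-(1:ℝ) / 6) * (1 - x 1) ^ (-(5:ℝ) / 6) * (1 - (1 - x 2) * x 1 / 2) ^ (-(1:ℝ) / 6))) =
      fun x => eulerKernel (-1 / 6) (x 0) (x 2) * eulerKernel (-1 / 6) (x 1) (x 2) := by
    funext x
    simp only [eulerKernel]
    norm_num
  obtain ⟨hint, hval⟩ := integral_cube_eulerKernel (ν := -1 / 6) (by norm_num) (by norm_num)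
  rw [hK]
  exact ⟨hint, by rw [hval, Gamma_five_sixths_mul_Gamma_one_sixth]⟩

/-- **`J₁ = 6√3 π log(2 + √3)`**: `(2π)² · (3√3/(2π)) log(2+√3)`, by `integral_cube_level_one` and
Zhou's value `∫₀¹ P_{-1/6}² = (3√3/(2π)) log(2+√3)` (Remark 9), a theorem of the tree
(`LegendreP.integral_legendreP_neg_one_sixth_sq`). [cite: Zhou2015, Remark 9 with eq. (Euler_int) (arXiv pp. 17, 19)] -/
theorem integral_cube_level_one_value :
    ∫ x in {x : Fin 3 → ℝ | ∀ i, x i ∈ Set.Ioo (0:ℝ) 1},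
        (x 0) ^ (-(1:ℝ) / 6) * (1 - x 0) ^ (-(5:ℝ) / 6) * (1 - (1 - x 2) * x 0 / 2) ^ (-(1:ℝ) / 6) *
          ((x 1) ^ (-(1:ℝ) / 6) * (1 - x 1) ^ (-(5:ℝ) / 6) * (1 - (1 - x 2) * x 1 / 2) ^ (-(1:ℝ) / 6))
      = 6 * √3 * π * Real.log (2 + √3) := by
  rw [integral_cube_level_one.2, integral_legendreP_neg_one_sixth_sq]
  have hπ : π ≠ 0 := Real.pi_ne_zero
  field_simp
  ring

/-- **`J₃ = 4√3 π log 2`** — the 3-dimensional period of item stmt-KontsevichZagierPeriods-4041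
(level 3, `((3+i√3)/6, i/√3)`): the integrand
`x₀^{-1/3}(1-x₀)^{-2/3}(1-(1-x₂)x₀/2)^{-1/3} · x₁^{-1/3}(1-x₁)^{-2/3}(1-(1-x₂)x₁/2)^{-1/3}` is absolutely
integrable on the open unit cube and its integral is `(2π/√3)² ∫₀¹ P_{-1/3}(ξ)² dξ = 4√3 π log 2`
(Zhou 2015, Remark 9: `∫₀¹ P_{-1/3}² = (3√3/π) log 2`, proved in the tree as
`integral_legendreP_neg_one_third_sq`; by the third display of Remark 9 this number is also
`-√3 π G` with `G = higherGreen 3 2 1 ((3+i√3)/6) (i/√3) = 2 G₂^{ℌ/Γ̄₀(3)}`).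
[cite: Zhou2015, Remark 9 with eq. (Euler_int) (arXiv pp. 17, 19)] -/
theorem integral_cube_level_three :
    IntegrableOn (fun x : Fin 3 → ℝ =>
        (x 0) ^ (-(1:ℝ) / 3) * (1 - x 0) ^ (-(2:ℝ) / 3) * (1 - (1 - x 2) * x 0 / 2) ^ (-(1:ℝ) / 3) *
          ((x 1) ^ (-(1:ℝ) / 3) * (1 - x 1) ^ (-(2:ℝ) / 3) * (1 - (1 - x 2) * x 1 / 2) ^ (-(1:ℝ) / 3)))
      {x | ∀ i, x i ∈ Set.Ioo (0:ℝ) 1} ∧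
    ∫ x in {x : Fin 3 → ℝ | ∀ i, x i ∈ Set.Ioo (0:ℝ) 1},
        (x 0) ^ (-(1:ℝ) / 3) * (1 - x 0) ^ (-(2:ℝ) / 3) * (1 - (1 - x 2) * x 0 / 2) ^ (-(1:ℝ) / 3) *
          ((x 1) ^ (-(1:ℝ) / 3) * (1 - x 1) ^ (-(2:ℝ) / 3) * (1 - (1 - x 2) * x 1 / 2) ^ (-(1:ℝ) / 3))
      = 4 * √3 * π * Real.log 2 := by
  have hK : (fun x : Fin 3 → ℝ =>
      (x 0) ^ (-(1:ℝ) / 3) * (1 - x 0) ^ (-(2:ℝ) / 3) * (1 - (1 - x 2) * x 0 / 2) ^ (-(1:ℝ) / 3) *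
        ((x 1) ^ (-(1:ℝ) / 3) * (1 - x 1) ^ (-(2:ℝ) / 3) * (1 - (1 - x 2) * x 1 / 2) ^ (-(1:ℝ) / 3))) =
      fun x => eulerKernel (-1 / 3) (x 0) (x 2) * eulerKernel (-1 / 3) (x 1) (x 2) := by
    funext x
    simp only [eulerKernel]
    norm_num
  obtain ⟨hint, hval⟩ := integral_cube_eulerKernel (ν := -1 / 3) (by norm_num) (by norm_num)
  rw [hK]
  refine ⟨hint, ?_⟩
  rw [hval, Gamma_two_thirds_mul_Gamma_one_third, integral_legendreP_neg_one_third_sq]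
  have hπ : π ≠ 0 := Real.pi_ne_zero
  have h3 : (√3 : ℝ) ≠ 0 := by positivity
  have h3sq : (√3 : ℝ) ^ 2 = 3 := Real.sq_sqrt (by norm_num)
  field_simp
  rw [h3sq]
  ring

/-! ## The values of the route's integral representations -/

/-- The open unit cube is Lebesgue measurable. [folklore] -/
theorem measurableSet_cube : MeasurableSet {x : Fin 3 → ℝ | ∀ i, x i ∈ Set.Ioo (0:ℝ) 1} := by
  rw [cube_eq_pi]
  exact MeasurableSet.univ_pi fun _ => measurableSet_Ioo

open Literature.NumberTheory.Transcendental in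
/-- **The value of the level-1 representation**: every Kontsevich–Zagier integral representation
`r` in dimension `3` whose domain is the open unit cube and whose integrand agrees there with
`x₀^{-1/6}(1-x₀)^{-5/6}(1-(1-x₂)x₀/2)^{-1/6} · x₁^{-1/6}(1-x₁)^{-5/6}(1-(1-x₂)x₁/2)^{-1/6}` (the hypotheses
on `r` in item stmt-KontsevichZagierPeriods-4040) has `r.value = J₁ = 6√3 π log(2+√3)`.
[cite: Zhou2015, Remark 9 with eq. (Euler_int) (arXiv pp. 17, 19)] -/
theorem KZ_value_level_one (r : KZ.IntegralRep 3)
    (hd : r.domain = {x | ∀ i, x i ∈ Set.Ioo (0:ℝ) 1})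
    (hf : Set.EqOn r.integrand (fun x => (x 0) ^ (-(1:ℝ) / 6) * (1 - x 0) ^ (-(5:ℝ) / 6) *
      (1 - (1 - x 2) * x 0 / 2) ^ (-(1:ℝ) / 6) * ((x 1) ^ (-(1:ℝ) / 6) * (1 - x 1) ^ (-(5:ℝ) / 6) *
      (1 - (1 - x 2) * x 1 / 2) ^ (-(1:ℝ) / 6))) r.domain) :
    r.value = 6 * √3 * π * Real.log (2 + √3) := by
  rw [KZ.IntegralRep.value, setIntegral_congr_fun (hd ▸ measurableSet_cube) hf, hd]
  exact integral_cube_level_one_value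

open Literature.NumberTheory.Transcendental in
/-- **The value of the level-3 representation**: every Kontsevich–Zagier integral representation
`r` in dimension `3` whose domain is the open unit cube and whose integrand agrees there with
`x₀^{-1/3}(1-x₀)^{-2/3}(1-(1-x₂)x₀/2)^{-1/3} · x₁^{-1/3}(1-x₁)^{-2/3}(1-(1-x₂)x₁/2)^{-1/3}` (the hypotheses
on `r` in item stmt-KontsevichZagierPeriods-4041) has `r.value = J₃ = 4√3 π log 2`.
[cite: Zhou2015, Remark 9 with eq. (Euler_int) (arXiv pp. 17, 19)] -/
theorem KZ_value_level_three (r : KZ.IntegralRep 3)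
    (hd : r.domain = {x | ∀ i, x i ∈ Set.Ioo (0:ℝ) 1})
    (hf : Set.EqOn r.integrand (fun x => (x 0) ^ (-(1:ℝ) / 3) * (1 - x 0) ^ (-(2:ℝ) / 3) *
      (1 - (1 - x 2) * x 0 / 2) ^ (-(1:ℝ) / 3) * ((x 1) ^ (-(1:ℝ) / 3) * (1 - x 1) ^ (-(2:ℝ) / 3) *
      (1 - (1 - x 2) * x 1 / 2) ^ (-(1:ℝ) / 3))) r.domain) :
    r.value = 4 * √3 * π * Real.log 2 := by
  rw [KZ.IntegralRep.value, setIntegral_congr_fun (hd ▸ measurableSet_cube) hf, hd]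
  exact integral_cube_level_three.2

end LegendreP

end Literature.NumberTheory.Automorphic

end
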